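import Mathlib

/-!
# A Galois-invariant class in the cokernel of the level-77 dihedral cobracket (solo-blind, s26; hodge.md §8.18.11)

Dictionary (as in `SoloBlindEisensteinClass`).  `D₁(N) = ℚ ⊗ (cyclotomic units of level N)` is generated
by `u_n` (`n mod N`, `u_0 := 0`) subject to evenness `u_{-n} = u_n` and the non-degenerate distribution
relations `Σ_{t mod q} u_{n + tN/q} = u_{qn}` (`q ∣ N` prime, `N ∤ qn`); by Bass (1966) these generate
all relations.  The weight-two part of Goncharov's dihedral Lie coalgebra has cobracket with image
`span{T(a,b,c) := u_a ∧ u_b + u_b ∧ u_c + u_c ∧ u_a : a + b + c ≡ 0 (mod N)} ⊆ Λ² D₁(N)`, and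
`k(N) := dim coker` is the defect of the Deligne–Goncharov bound in weight two: `d^𝔪(2,N) = D(2,N) − k(N)`.

The classes certified so far (`SoloBlindEisensteinClass*`: levels 34, 39, 55, 62, 68, 82, 86, 91, 95,
111, 117) are all of "Eisenstein type" `E_ε ∧ J` and live in NON-trivial isotypic components for the
action `σ_c : u_n ↦ u_{cn}` of `(ℤ/N)ˣ`.  At `N = 77 = 7·11` that recipe gives nothing
(`χ₇(11) = 1` but `χ₇` is odd; no even `ε ≠ 1 mod 7` or `mod 11` takes the value `1` at the other prime),
yet exact computation gives `k(77) = 15`, one class in each of the fifteen totally even isotypic components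
— including the TRIVIAL one.  This file certifies that invariant class: an explicit antisymmetric kernel
`Φ₇₇ : ℤ/77 × ℤ/77 → ℤ` with values in `{0, ±1, ±4, ±5, ±6, ±12}`, given by a short case formula in the
residues mod 7 and mod 11, which

* is odd under exchange and even in each slot, vanishes against `u_0`,
* respects every non-degenerate distribution relation of level 77 in the second slot (hence, by
  antisymmetry, in the first), i.e. is a well-defined functional on `Λ² D₁(77)`,
* kills every three-term tensor `T(a,b,c)`, `a + b + c ≡ 0 (mod 77)`,
* is invariant: `Φ₇₇(cm, cn) = Φ₇₇(m, n)` for every unit `c` (checked for the generators `c = 2, 3`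
  of `(ℤ/77)ˣ`), and is non-zero (`Φ₇₇(11, 7) = 1`).

Granting the dictionary, `Φ₇₇` spans a `(ℤ/77)ˣ`-invariant line in `(coker)^∨`, so `k(77) ≥ 1` with a
class of a new kind (exact linear algebra: the invariant part is exactly this line, and `k(77) = 15`).
In the modular dictionary (Goncharov) it is a weight-two modular-symbol class for `Γ₀(77)` that is
invariant under both degeneracy (distribution) correspondences — the first instance of the law
`dim (coker)^∨_ψ = max(0, (p−5)(q−5)/12 − S₄(ψ)/4 − S₃(ψ)/3 − δ_ψ)` found numerically for `N = pq`,
`7 ≤ p < q` (hodge §8.18.11), here `(2·6)/12 − 0 − 0 = 1`.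

All statements are finite and checked by the kernel (`decide +kernel`, no `native_decide`).
-/

set_option maxRecDepth 8192

namespace Summit.KontsevichZagierPeriods.KontsevichZagierPeriods.Theorems.SoloBlindLevel77Class

/-- `m` is a unit mod 77. -/
def isU (m : ℕ) : Bool := m % 7 != 0 && m % 11 != 0
/-- `m` is a non-zero multiple of 7 mod 77. -/
def isA (m : ℕ) : Bool := m % 7 == 0 && m % 11 != 0
/-- `m` is a non-zero multiple of 11 mod 77. -/
def isB (m : ℕ) : Bool := m % 7 != 0 && m % 11 == 0
/-- `a ≡ ± k·b (mod 11)`. -/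
def pmk (k a b : ℕ) : Bool := (a % 11 == (k * b) % 11) || ((a + k * b) % 11 == 0)
/-- `n ≡ r·m (mod 77)` for some `r` in the list. -/
def hit (rs : List ℕ) (m n : ℕ) : Bool := rs.any (fun r => (r * m) % 77 == n % 77)
/-- Boolean to integer. -/
def bi (b : Bool) : ℤ := if b then 1 else 0

/-- THE LEVEL-77 INVARIANT CLASS.  On (unit, unit): `±5` according as `n/m ∈ ±{2, 15, 25}` or
`n/m ∈ ±{36, 37, 39}` (the inverses); on (unit, 7ℤ): `1 − 5·[n ≡ ±2m (11)]`; on (7ℤ, 7ℤ):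
`12·[n ≡ ±2m] + 6·[n ≡ ±3m] − 6·[n ≡ ±4m] − 12·[n ≡ ±5m] (mod 11)`; on (7ℤ, 11ℤ): `−1`;
on (unit, 11ℤ) and (11ℤ, 11ℤ): `0`; the rest by antisymmetry; zero row and column at `0`. -/
def phi77 (m n : ℕ) : ℤ :=
  if isU m && isU n then
    (if hit [2, 15, 25, 52, 62, 75] m n then 5
     else if hit [36, 37, 38, 39, 40, 41] m n then -5 else 0)
  else if isU m && isA n then 1 - 5 * bi (pmk 2 n m)
  else if isA m && isU n then -1 + 5 * bi (pmk 2 m n)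
  else if isA m && isA n then
    12 * bi (pmk 2 n m) + 6 * bi (pmk 3 n m) - 6 * bi (pmk 4 n m) - 12 * bi (pmk 5 n m)
  else if isA m && isB n then -1
  else if isB m && isA n then 1
  else 0

/-- `Φ` is antisymmetric and even in the second slot, with zero column at `0` (residues `< N`). -/
def WellFormed (N : ℕ) (Φ : ℕ → ℕ → ℤ) : Prop :=
  ∀ m < N, ∀ n < N, Φ m n = -Φ n m ∧ Φ m ((N - n) % N) = Φ m n ∧ Φ m 0 = 0

/-- `Φ` respects, in its second slot, the non-degenerate distribution relations of level `N` for the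
prime `q ∣ N`: `Σ_{t<q} Φ(m, (n + t·N/q) mod N) = Φ(m, q·n mod N)` whenever `N ∤ q·n`. -/
def RespectsDist₂ (N q : ℕ) (Φ : ℕ → ℕ → ℤ) : Prop :=
  ∀ m < N, ∀ n < N, (q * n) % N ≠ 0 →
    ((List.range q).map (fun t => Φ m ((n + t * (N / q)) % N))).sum = Φ m ((q * n) % N)

/-- `Φ` kills every cyclic three-term tensor `T(a,b,c)`, `a + b + c ≡ 0 (mod N)`. -/
def KillsThreeTerm (N : ℕ) (Φ : ℕ → ℕ → ℤ) : Prop :=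
  ∀ a < N, ∀ b < N,
    Φ a b + Φ b ((2 * N - a - b) % N) + Φ ((2 * N - a - b) % N) a = 0

/-- `Φ` is invariant under the diagonal action of the unit `c`: `Φ(cm, cn) = Φ(m, n)`. -/
def InvariantUnder (N c : ℕ) (Φ : ℕ → ℕ → ℤ) : Prop :=
  ∀ m < N, ∀ n < N, Φ ((c * m) % N) ((c * n) % N) = Φ m n

/-- `Φ₇₇` is antisymmetric, even in the second slot and zero against `u_0`. -/
theorem phi77_wellFormed : WellFormed 77 phi77 := by
  unfold WellFormed; decide +kernel

/-- `Φ₇₇` respects the non-degenerate distribution relations for `q = 7` (second slot). -/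
theorem phi77_dist7 : RespectsDist₂ 77 7 phi77 := by
  unfold RespectsDist₂; decide +kernel

/-- `Φ₇₇` respects the non-degenerate distribution relations for `q = 11` (second slot). -/
theorem phi77_dist11 : RespectsDist₂ 77 11 phi77 := by
  unfold RespectsDist₂; decide +kernel

/-- `Φ₇₇` kills every three-term tensor `T(a,b,c)`, `a + b + c ≡ 0 (mod 77)`. -/
theorem phi77_killsThreeTerm : KillsThreeTerm 77 phi77 := by
  unfold KillsThreeTerm; decide +kernel

/-- `Φ₇₇` is invariant under the units `2` and `3`, which generate `(ℤ/77)ˣ`. -/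
theorem phi77_invariant : InvariantUnder 77 2 phi77 ∧ InvariantUnder 77 3 phi77 := by
  unfold InvariantUnder; constructor <;> decide +kernel

/-- THE LEVEL-77 INVARIANT CLASS (summary): `Φ₇₇` is a well-defined, `(ℤ/77)ˣ`-invariant antisymmetric
functional on `Λ² D₁(77)` that kills every three-term tensor and is non-zero (`Φ₇₇(11,7) = 1`).
Granting the dictionary of the module docstring: `k(77) ≥ 1`, witnessed in the trivial isotypic component. -/
theorem level77InvariantClass :
    WellFormed 77 phi77 ∧ RespectsDist₂ 77 7 phi77 ∧ RespectsDist₂ 77 11 phi77 ∧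
    KillsThreeTerm 77 phi77 ∧ InvariantUnder 77 2 phi77 ∧ InvariantUnder 77 3 phi77 ∧
    phi77 11 7 = 1 :=
  ⟨phi77_wellFormed, phi77_dist7, phi77_dist11, phi77_killsThreeTerm, phi77_invariant.1,
   phi77_invariant.2, by decide⟩

end Summit.KontsevichZagierPeriods.KontsevichZagierPeriods.Theorems.SoloBlindLevel77Class
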